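import Summits.HodgeConjecture.HodgeConjecture.Theorems.SecondaryPeriodsRiemannWeightOneStubAlgebraisationSmoothRootCounting
import Literature.AlgebraicGeometry.Resolution.AffineDomainEquidim
import Literature.RingTheory.KrullDimension.AffineDimension
import Mathlib.RingTheory.RegularLocalRing.Defs
import Mathlib.RingTheory.Nakayama
import Mathlib.RingTheory.Ideal.Operations
import HarnessLib

/-!
# Crux `RiemannWeightOne` (stmt-HodgeConjecture-16406), stub `stub_algebraisationSmooth`, part (A): from simple branches to a regular local ring

Helper file for the registered stub `stub_algebraisationSmooth` (Serre, GAGA §2 n°6). Setting of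
part (B) (`…StubAlgebraisationSmoothRootCounting`): `R = ℂ[T₁, …, T_d] → B` injective and
integral, `B` an affine domain, `e₀ : B → ℂ` a point with maximal ideal `𝔪 = ker e₀` and
coordinates `a = t(e₀)`, and `J = (t₁ - a₁, …, t_d - a_d) ⊆ 𝔪`.

* `LocalRegularity.mem_J_sup_sq_of_derivative_ne_zero` — **(A) the cotangent computation.** If
  `ℓ ∈ 𝔪` satisfies `G(t, ℓ) = 0` for `G ∈ R[Y]` with `∂G/∂Y(a, 0) ≠ 0` (the output of part (B)),
  then `ℓ ∈ J + 𝔪²`: modulo `J` the coefficients of `G` are their values at `a`, and modulo `𝔪²`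
  only the constant and the linear term in `ℓ` survive, so `g_a(0) + g_a'(0) ℓ ∈ J + 𝔪²` with
  `g_a(0) = 0`.
* `LocalRegularity.ker_le_J_sup_sq` — if this holds for every `ℓ ∈ 𝔪` SEPARATING `e₀` from the
  (finitely many) other points with the same coordinates, then `𝔪 ⊆ J + 𝔪²`: prime avoidance gives
  one separating `ℓ₀ ∈ 𝔪`, and every `b ∈ 𝔪` is a combination of the separating `b + c ℓ₀`,
  `c ∈ ℂ` generic.
* `LocalRegularity.isRegularLocalRing_of_ker_le` — **then `B_𝔪` is a regular local ring of
  dimension `d`**: by Nakayama `𝔪 B_𝔪 = J B_𝔪` is generated by `d` elements, and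
  `dim B_𝔪 = dim B = dim R = d` (affine domains are equidimensional, the tree's
  `Resolution.ringKrullDim_localization_atPrime_eq_of_isMaximal`, and integral extensions preserve
  dimension, `Literature.RingTheory.KrullDimension.ringKrullDim_eq_of_isIntegral`).

## References

* [SerreGAGA1956] J.-P. Serre, GAGA, Ann. Inst. Fourier 6 (1956), §2 n°6 Prop. 3 and Cor. 2.
* [Matsumura1987] H. Matsumura, Commutative Ring Theory, Thm. 5.6, Thm. 14.2.
-/

noncomputable section

set_option linter.dupNamespace false

namespace Summit.HodgeConjecture.HodgeConjecture.Theorems.RiemannWeightOne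

namespace LocalRegularity

open Polynomial RootCounting

variable {d : ℕ} {B : Type*} [CommRing B] [Algebra ℂ B]
  [Algebra (MvPolynomial (Fin d) ℂ) B] [IsScalarTower ℂ (MvPolynomial (Fin d) ℂ) B]

local notation "R" => MvPolynomial (Fin d) ℂ

/-! ### The ideal `J = (t₁ - a₁, …, t_d - a_d)` -/

/-- The ideal `J(a) = (t₁ - a₁, …, t_d - a_d) ⊆ B` of the coordinate values `a ∈ ℂᵈ`. [folklore] -/
def J (a : Fin d → ℂ) : Ideal B :=
  Ideal.span (Set.range fun i : Fin d => algebraMap R B (MvPolynomial.X i) - algebraMap ℂ B (a i))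

omit [IsScalarTower ℂ (MvPolynomial (Fin d) ℂ) B] in
/-- The generators lie in `J`. [folklore] -/
theorem sub_mem_J (a : Fin d → ℂ) (i : Fin d) :
    algebraMap R B (MvPolynomial.X i) - algebraMap ℂ B (a i) ∈ (J a : Ideal B) :=
  Ideal.subset_span ⟨i, rfl⟩

/-- **A polynomial is congruent to its value modulo `J`**: `r(t) - r(a) ∈ J(a)`. [folklore] -/
theorem algebraMap_sub_mem_J (a : Fin d → ℂ) (r : R) :
    algebraMap R B r - algebraMap ℂ B (MvPolynomial.eval a r) ∈ (J a : Ideal B) := by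
  induction r using MvPolynomial.induction_on with
  | C c =>
    have h : algebraMap R B (MvPolynomial.C c) = algebraMap ℂ B c := by
      rw [IsScalarTower.algebraMap_apply ℂ (MvPolynomial (Fin d) ℂ) B]
      rfl
    rw [MvPolynomial.eval_C, h, sub_self]
    exact Ideal.zero_mem _
  | add p q hp hq =>
    have : algebraMap R B (p + q) - algebraMap ℂ B (MvPolynomial.eval a (p + q)) =
        (algebraMap R B p - algebraMap ℂ B (MvPolynomial.eval a p)) +
        (algebraMap R B q - algebraMap ℂ B (MvPolynomial.eval a q)) := by
      simp only [map_add]; ring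
    rw [this]
    exact Ideal.add_mem _ hp hq
  | mul_X p i hp =>
    have : algebraMap R B (p * MvPolynomial.X i) - algebraMap ℂ B (MvPolynomial.eval a (p * MvPolynomial.X i)) =
        algebraMap R B p * (algebraMap R B (MvPolynomial.X i) - algebraMap ℂ B (a i)) +
        algebraMap ℂ B (a i) * (algebraMap R B p - algebraMap ℂ B (MvPolynomial.eval a p)) := by
      simp only [map_mul, MvPolynomial.eval_X]; ring
    rw [this]
    exact Ideal.add_mem _ (Ideal.mul_mem_left _ _ (sub_mem_J a i)) (Ideal.mul_mem_left _ _ hp)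

omit [IsScalarTower ℂ (MvPolynomial (Fin d) ℂ) B] in
/-- `J(t(e₀)) ⊆ ker e₀`. [folklore] -/
theorem J_le_ker (e₀ : B →ₐ[ℂ] ℂ) : (J (coords (d := d) e₀) : Ideal B) ≤ RingHom.ker (e₀ : B →+* ℂ) := by
  rw [J, Ideal.span_le]
  rintro _ ⟨i, rfl⟩
  rw [SetLike.mem_coe, RingHom.mem_ker]
  simp [coords]

/-! ### (A) The cotangent computation -/

/-- **(A) `ℓ ∈ J + 𝔪²` if `ℓ ∈ 𝔪` satisfies `G(t, ℓ) = 0` with `∂G/∂Y (a, 0) ≠ 0`.** Modulo `J`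
the coefficients `r_j(t)` of `G` are the constants `r_j(a)`, and `(r_j(t) - r_j(a)) ℓʲ ∈ J𝔪 ⊆ 𝔪²`
for `j ≥ 1`; modulo `𝔪²` the powers `ℓʲ`, `j ≥ 2`, vanish. Hence
`r₀(a) + r₁(a) ℓ ∈ J + 𝔪²`; applying `e₀` gives `r₀(a) = 0`, and `r₁(a) = ∂G/∂Y(a, 0) ≠ 0`.
[cite: SerreGAGA1956, §2 n°6 Prop. 3 Cor. 2] -/
theorem mem_J_sup_sq_of_derivative_ne_zero (e₀ : B →ₐ[ℂ] ℂ) (ℓ : B) (hℓ : e₀ ℓ = 0) (G : R[X])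
    (hG : Polynomial.aeval ℓ G = 0)
    (hder : ((G.map (MvPolynomial.eval (coords (d := d) e₀))).derivative).eval 0 ≠ 0) :
    ℓ ∈ (J (coords (d := d) e₀) : Ideal B) ⊔ (RingHom.ker (e₀ : B →+* ℂ)) ^ 2 := by
  set a := coords (d := d) e₀ with ha
  set 𝔪 : Ideal B := RingHom.ker (e₀ : B →+* ℂ) with h𝔪
  set I : Ideal B := J a ⊔ 𝔪 ^ 2 with hI
  have hJm : (J a : Ideal B) ≤ 𝔪 := J_le_ker e₀
  have hℓm : ℓ ∈ 𝔪 := by rw [h𝔪, RingHom.mem_ker]; exact hℓ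
  -- the coefficients and their values
  set c : ℕ → ℂ := fun j => MvPolynomial.eval a (G.coeff j) with hc
  -- `Σ_j (r_j(t) - r_j(a)) ℓ^j ∈ J + 𝔪²`
  have hdiff : ∀ j, (algebraMap R B (G.coeff j) - algebraMap ℂ B (c j)) * ℓ ^ j ∈ I := by
    intro j
    rcases Nat.eq_zero_or_pos j with rfl | hj
    · rw [pow_zero, mul_one]
      exact Ideal.mem_sup_left (algebraMap_sub_mem_J a _)
    · refine Ideal.mem_sup_right ?_
      rw [pow_two]
      refine Ideal.mul_mem_mul (hJm (algebraMap_sub_mem_J a _)) ?_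
      exact Ideal.pow_mem_of_mem 𝔪 hℓm j hj
  -- `Σ_j r_j(t) ℓ^j = 0`
  have hsum : ∑ j ∈ Finset.range (G.natDegree + 1), algebraMap R B (G.coeff j) * ℓ ^ j = 0 := by
    rw [Polynomial.aeval_def, eval₂_eq_sum_range] at hG
    exact hG
  -- hence `Σ_j r_j(a) ℓ^j ∈ J + 𝔪²`
  have hval : ∑ j ∈ Finset.range (G.natDegree + 1), algebraMap ℂ B (c j) * ℓ ^ j ∈ I := by
    have h : ∑ j ∈ Finset.range (G.natDegree + 1), algebraMap ℂ B (c j) * ℓ ^ j =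
        ∑ j ∈ Finset.range (G.natDegree + 1), algebraMap R B (G.coeff j) * ℓ ^ j -
        ∑ j ∈ Finset.range (G.natDegree + 1), (algebraMap R B (G.coeff j) - algebraMap ℂ B (c j)) * ℓ ^ j := by
      rw [← Finset.sum_sub_distrib]
      exact Finset.sum_congr rfl fun j _ => by ring
    rw [h, hsum, zero_sub]
    exact I.neg_mem_iff.2 (Ideal.sum_mem _ fun j _ => hdiff j)
  -- the terms `j ≥ 2` lie in `𝔪²`
  have hhigh : ∀ j, 2 ≤ j → algebraMap ℂ B (c j) * ℓ ^ j ∈ I := fun j hj =>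
    Ideal.mem_sup_right (Ideal.mul_mem_left _ _ (by
      rw [show j = (j - 2) + 2 from by omega, pow_add]
      exact Ideal.mul_mem_left _ _ (Ideal.pow_mem_pow hℓm 2)))
  -- so `c₀ + c₁ ℓ ∈ I`
  have hlow : algebraMap ℂ B (c 0) + algebraMap ℂ B (c 1) * ℓ ∈ I := by
    have hsplit : ∀ n, 2 ≤ n → (∑ j ∈ Finset.range n, algebraMap ℂ B (c j) * ℓ ^ j ∈ I ↔
        algebraMap ℂ B (c 0) + algebraMap ℂ B (c 1) * ℓ ∈ I) := by
      intro n hn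
      induction n with
      | zero => omega
      | succ n ih =>
        rcases Nat.lt_or_ge n 2 with hn2 | hn2
        · have : n = 1 := by omega
          subst this
          simp [Finset.sum_range_succ]
        · rw [Finset.sum_range_succ]
          rw [← ih hn2]
          constructor
          · intro h
            have := Ideal.sub_mem _ h (hhigh n hn2)
            rwa [add_sub_cancel_right] at this
          · intro h
            exact Ideal.add_mem _ h (hhigh n hn2)
    by_cases hN : 2 ≤ G.natDegree + 1
    · exact (hsplit _ hN).1 hval
    · -- `deg G = 0`: then `g_a' = 0`, contradicting `hder`
      exfalso
      apply hder
      have hdeg : G.natDegree = 0 := by omega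
      rw [Polynomial.eq_C_of_natDegree_eq_zero hdeg]
      simp
  -- apply `e₀`: `c₀ = 0`
  have hIm : I ≤ 𝔪 := sup_le hJm (Ideal.pow_le_self two_ne_zero)
  have hc0 : c 0 = 0 := by
    have h := hIm hlow
    rw [h𝔪, RingHom.mem_ker] at h
    simp only [map_add, map_mul, AlgHom.coe_toRingHom, AlgHom.commutes, Algebra.algebraMap_self,
      RingHom.id_apply, hℓ, mul_zero, add_zero] at h
    exact h
  -- `c₁ = g_a'(0) ≠ 0`
  have hc1 : c 1 = ((G.map (MvPolynomial.eval a)).derivative).eval 0 := by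
    rw [← coeff_zero_eq_eval_zero, coeff_derivative, coeff_map]
    simp [hc]
  have hc1ne : c 1 ≠ 0 := by rw [hc1]; exact hder
  rw [hc0, map_zero, zero_add] at hlow
  have h := Ideal.mul_mem_left I (algebraMap ℂ B (c 1)⁻¹) hlow
  rwa [← mul_assoc, ← map_mul, inv_mul_cancel₀ hc1ne, map_one, one_mul] at h

/-! ### All of `𝔪` from separating elements -/

/-- Distinct `ℂ`-points have distinct kernels. [folklore] -/
theorem algHom_eq_of_ker_le {ψ ψ' : B →ₐ[ℂ] ℂ}
    (h : RingHom.ker (ψ : B →+* ℂ) ≤ RingHom.ker (ψ' : B →+* ℂ)) : ψ = ψ' := by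
  refine AlgHom.ext fun b => ?_
  have hb : b - algebraMap ℂ B (ψ b) ∈ RingHom.ker (ψ : B →+* ℂ) := by
    rw [RingHom.mem_ker]; simp
  have hb' := h hb
  rw [RingHom.mem_ker] at hb'
  simp only [map_sub, AlgHom.coe_toRingHom, AlgHom.commutes, Algebra.algebraMap_self,
    RingHom.id_apply] at hb'
  exact (sub_eq_zero.1 hb').symm

omit [IsScalarTower ℂ (MvPolynomial (Fin d) ℂ) B] in
/-- **`𝔪 ⊆ J + 𝔪²` from the separating elements.** Suppose the points with the coordinates of
`e₀` are finite in number and every `ℓ ∈ 𝔪` separating `e₀` from the others lies in `J + 𝔪²`.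
Then `𝔪 ⊆ J + 𝔪²`: prime avoidance (`Ideal.subset_union_prime`) gives a separating `ℓ₀ ∈ 𝔪`, and
for `b ∈ 𝔪` the elements `b + c ℓ₀` are separating for all but finitely many `c ∈ ℂ`; two of them
recover `b`. [folklore] -/
theorem ker_le_J_sup_sq (e₀ : B →ₐ[ℂ] ℂ)
    (hfin : {ψ : B →ₐ[ℂ] ℂ | coords (d := d) ψ = coords (d := d) e₀}.Finite)
    (hgood : ∀ ℓ : B, e₀ ℓ = 0 → (∀ ψ : B →ₐ[ℂ] ℂ, coords (d := d) ψ = coords (d := d) e₀ → ψ ℓ = 0 → ψ = e₀) →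
      ℓ ∈ (J (coords (d := d) e₀) : Ideal B) ⊔ (RingHom.ker (e₀ : B →+* ℂ)) ^ 2) :
    RingHom.ker (e₀ : B →+* ℂ) ≤ (J (coords (d := d) e₀) : Ideal B) ⊔ (RingHom.ker (e₀ : B →+* ℂ)) ^ 2 := by
  classical
  set 𝔪 : Ideal B := RingHom.ker (e₀ : B →+* ℂ) with h𝔪
  set I : Ideal B := J (coords (d := d) e₀) ⊔ 𝔪 ^ 2 with hI
  -- the other points of the fibre
  set F : Finset (B →ₐ[ℂ] ℂ) := (hfin.toFinset.erase e₀) with hF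
  have hF_mem : ∀ ψ, ψ ∈ F ↔ coords (d := d) ψ = coords (d := d) e₀ ∧ ψ ≠ e₀ := fun ψ => by
    rw [hF, Finset.mem_erase, Set.Finite.mem_toFinset, Set.mem_setOf_eq]; tauto
  -- a separating `ℓ₀ ∈ 𝔪` by prime avoidance
  have havoid : ¬ ((𝔪 : Set B) ⊆ ⋃ ψ ∈ (↑F : Set (B →ₐ[ℂ] ℂ)), (RingHom.ker (ψ : B →+* ℂ) : Set B)) := by
    rw [Ideal.subset_union_prime e₀ e₀ (fun ψ _ _ _ => RingHom.ker_isPrime (ψ : B →+* ℂ))]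
    rintro ⟨ψ, hψF, hle⟩
    exact ((hF_mem ψ).1 hψF).2 (algHom_eq_of_ker_le hle).symm
  rw [Set.not_subset] at havoid
  obtain ⟨ℓ₀, hℓ₀m, hℓ₀⟩ := havoid
  simp only [Set.mem_iUnion, SetLike.mem_coe, RingHom.mem_ker, AlgHom.coe_toRingHom, not_exists] at hℓ₀
  have hℓ₀e : e₀ ℓ₀ = 0 := by
    rw [SetLike.mem_coe, h𝔪, RingHom.mem_ker] at hℓ₀m
    exact hℓ₀m
  -- separating elements of the form `b + c ℓ₀`
  have hsep : ∀ b : B, e₀ b = 0 → ∀ c : ℂ, (∀ ψ ∈ F, ψ b + c * ψ ℓ₀ ≠ 0) →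
      b + algebraMap ℂ B c * ℓ₀ ∈ I := by
    intro b hb c hc
    refine hgood _ (by simp [hb, hℓ₀e]) fun ψ hψc hψ0 => ?_
    by_contra hne
    have hψF : ψ ∈ F := (hF_mem ψ).2 ⟨hψc, hne⟩
    refine hc ψ hψF ?_
    simpa using hψ0
  intro b hbm
  have hb : e₀ b = 0 := by rwa [h𝔪, RingHom.mem_ker] at hbm
  -- the bad values of `c`
  set bad : Finset ℂ := F.image fun ψ => -(ψ b) / ψ ℓ₀ with hbad
  have hgoodc : ∀ c : ℂ, c ∉ bad → ∀ ψ ∈ F, ψ b + c * ψ ℓ₀ ≠ 0 := by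
    intro c hc ψ hψF h0
    refine hc (Finset.mem_image.2 ⟨ψ, hψF, ?_⟩)
    have hψℓ₀ : ψ ℓ₀ ≠ 0 := hℓ₀ ψ hψF
    rw [div_eq_iff hψℓ₀]
    linear_combination -h0
  -- two distinct good values
  obtain ⟨c₁, hc₁⟩ := Infinite.exists_notMem_finset bad
  obtain ⟨c₂, hc₂⟩ := Infinite.exists_notMem_finset (insert c₁ bad)
  rw [Finset.mem_insert, not_or] at hc₂
  have h₁ := hsep b hb c₁ (hgoodc c₁ hc₁)
  have h₂ := hsep b hb c₂ (hgoodc c₂ hc₂.2)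
  -- `(c₂ - c₁) b = c₂ (b + c₁ ℓ₀) - c₁ (b + c₂ ℓ₀)`
  have hcomb : algebraMap ℂ B (c₂ - c₁) * b =
      algebraMap ℂ B c₂ * (b + algebraMap ℂ B c₁ * ℓ₀) - algebraMap ℂ B c₁ * (b + algebraMap ℂ B c₂ * ℓ₀) := by
    simp only [map_sub]; ring
  have hne : c₂ - c₁ ≠ 0 := sub_ne_zero.2 hc₂.1
  have hmem : algebraMap ℂ B (c₂ - c₁) * b ∈ I := by
    rw [hcomb]
    exact Ideal.sub_mem _ (Ideal.mul_mem_left _ _ h₁) (Ideal.mul_mem_left _ _ h₂)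
  have h := Ideal.mul_mem_left I (algebraMap ℂ B (c₂ - c₁)⁻¹) hmem
  rwa [← mul_assoc, ← map_mul, inv_mul_cancel₀ hne, map_one, one_mul] at h

/-! ### Regularity -/

/-- **`B_𝔪` is regular of dimension `d` if `𝔪 ⊆ J + 𝔪²`** (`B` an affine domain integral over
`ℂ[T₁, …, T_d]` acting faithfully, `𝔪 = ker e₀`): by Nakayama `𝔪 B_𝔪 = J B_𝔪` needs only the `d`
generators `tᵢ - aᵢ`, while `dim B_𝔪 = dim B = d`. [cite: Matsumura1987, Thm. 5.6 and Thm. 14.2] -/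
theorem isRegularLocalRing_of_ker_le {B : Type} [CommRing B] [IsDomain B] [Algebra ℂ B]
    [Algebra (MvPolynomial (Fin d) ℂ) B] [IsScalarTower ℂ (MvPolynomial (Fin d) ℂ) B]
    [Module.IsTorsionFree (MvPolynomial (Fin d) ℂ) B] [Algebra.IsIntegral (MvPolynomial (Fin d) ℂ) B]
    [Algebra.FiniteType ℂ B] (𝔪 : Ideal B) [𝔪.IsMaximal] (e₀ : B →ₐ[ℂ] ℂ)
    (he₀ : RingHom.ker (e₀ : B →+* ℂ) = 𝔪)
    (hle : 𝔪 ≤ (J (coords (d := d) e₀) : Ideal B) ⊔ 𝔪 ^ 2) :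
    IsRegularLocalRing (Localization.AtPrime 𝔪) ∧ ringKrullDim (Localization.AtPrime 𝔪) = d := by
  classical
  set L := Localization.AtPrime 𝔪
  haveI : IsNoetherianRing B := Algebra.FiniteType.isNoetherianRing ℂ B
  haveI : IsNoetherianRing L := IsLocalization.isNoetherianRing 𝔪.primeCompl L inferInstance
  -- dimension
  have hdimB : ringKrullDim B = d := by
    have hinj : Function.Injective (algebraMap (MvPolynomial (Fin d) ℂ) B) :=
      (faithfulSMul_iff_algebraMap_injective _ B).1 inferInstance
    rw [← Literature.RingTheory.KrullDimension.ringKrullDim_eq_of_isIntegral hinj,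
      MvPolynomial.ringKrullDim_of_isNoetherianRing, ringKrullDim_eq_zero_of_field]
    simp
  have hdimL : ringKrullDim L = d := by
    rw [Literature.AlgebraicGeometry.Resolution.ringKrullDim_localization_atPrime_eq_of_isMaximal ℂ 𝔪,
      hdimB]
  refine ⟨?_, hdimL⟩
  -- the maximal ideal is generated by the images of the `tᵢ - aᵢ`
  set gens : Fin d → L := fun i => algebraMap B L
    (algebraMap (MvPolynomial (Fin d) ℂ) B (MvPolynomial.X i) - algebraMap ℂ B (coords (d := d) e₀ i)) with hgens
  have hJmap : (J (coords (d := d) e₀) : Ideal B).map (algebraMap B L) = Ideal.span (Set.range gens) := by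
    rw [J, Ideal.map_span, ← Set.range_comp]
    rfl
  have hmax : IsLocalRing.maximalIdeal L = Ideal.span (Set.range gens) := by
    have hmL : IsLocalRing.maximalIdeal L = 𝔪.map (algebraMap B L) :=
      (Localization.AtPrime.map_eq_maximalIdeal).symm
    apply le_antisymm
    · -- Nakayama
      have hle' : IsLocalRing.maximalIdeal L ≤ Ideal.span (Set.range gens) ⊔
          IsLocalRing.maximalIdeal L • IsLocalRing.maximalIdeal L := by
        rw [hmL, ← hJmap, Ideal.smul_eq_mul, ← Ideal.map_mul, ← Ideal.map_sup, ← pow_two]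
        exact Ideal.map_mono hle
      refine Submodule.le_of_le_smul_of_le_jacobson_bot (IsNoetherian.noetherian _) ?_ hle'
      rw [IsLocalRing.jacobson_eq_maximalIdeal ⊥ bot_ne_top]
    · rw [hmL, ← hJmap]
      exact Ideal.map_mono ((J_le_ker e₀).trans (le_of_eq he₀))
  refine IsRegularLocalRing.of_spanFinrank_maximalIdeal_le L ?_
  rw [hdimL, hmax]
  have h1 : (Ideal.span (Set.range gens)).spanFinrank ≤ (Set.range gens).ncard :=
    Submodule.spanFinrank_span_le_ncard_of_finite (Set.finite_range gens)
  have h2 : (Set.range gens).ncard ≤ d := by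
    have h : Set.range gens = ↑(Finset.univ.image gens) := by
      rw [Finset.coe_image, Finset.coe_univ, Set.image_univ]
    rw [h, Set.ncard_coe_finset]
    exact Finset.card_image_le.trans (by simp)
  exact_mod_cast h1.trans h2

/-- **Summary of part (A).** If the points over `t(e₀)` are finitely many and every `ℓ ∈ 𝔪`
separating `e₀` from the others satisfies a relation `G(t, ℓ) = 0` with `∂G/∂Y(t e₀, 0) ≠ 0`
(part (B)), then `B_𝔪` is a regular local ring of dimension `d`.
[cite: SerreGAGA1956, §2 n°6 Prop. 3 and Cor. 2] -/
theorem isRegularLocalRing_of_branches {B : Type} [CommRing B] [IsDomain B] [Algebra ℂ B]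
    [Algebra (MvPolynomial (Fin d) ℂ) B] [IsScalarTower ℂ (MvPolynomial (Fin d) ℂ) B]
    [Module.IsTorsionFree (MvPolynomial (Fin d) ℂ) B] [Algebra.IsIntegral (MvPolynomial (Fin d) ℂ) B]
    [Algebra.FiniteType ℂ B] (𝔪 : Ideal B) [𝔪.IsMaximal] (e₀ : B →ₐ[ℂ] ℂ)
    (he₀ : RingHom.ker (e₀ : B →+* ℂ) = 𝔪)
    (hfin : {ψ : B →ₐ[ℂ] ℂ | coords (d := d) ψ = coords (d := d) e₀}.Finite)
    (hbranch : ∀ ℓ : B, e₀ ℓ = 0 →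
      (∀ ψ : B →ₐ[ℂ] ℂ, coords (d := d) ψ = coords (d := d) e₀ → ψ ℓ = 0 → ψ = e₀) →
      ∃ G : (MvPolynomial (Fin d) ℂ)[X], Polynomial.aeval ℓ G = 0 ∧
        ((G.map (MvPolynomial.eval (coords (d := d) e₀))).derivative).eval 0 ≠ 0) :
    IsRegularLocalRing (Localization.AtPrime 𝔪) ∧ ringKrullDim (Localization.AtPrime 𝔪) = d := by
  refine isRegularLocalRing_of_ker_le 𝔪 e₀ he₀ ?_
  rw [← he₀]
  refine ker_le_J_sup_sq e₀ hfin fun ℓ hℓ hsep => ?_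
  obtain ⟨G, hG, hder⟩ := hbranch ℓ hℓ hsep
  exact mem_J_sup_sq_of_derivative_ne_zero e₀ ℓ hℓ G hG hder

end LocalRegularity

/-- **Registered sub-goal `stub_algebraisationSmooth_localRegularity`** of the stub
`stub_algebraisationSmooth` (part (A): the local ring at a point all of whose separating elements
have simple branches is regular of dimension `d`, `LocalRegularity.isRegularLocalRing_of_branches`).
[cite: SerreGAGA1956, §2 n°6 Prop. 3 and Cor. 2] -/
theorem stub_algebraisationSmooth_localRegularity :
    ∀ ⦃d : ℕ⦄ ⦃B : Type⦄ [CommRing B] [IsDomain B] [Algebra ℂ B] [Algebra (MvPolynomial (Fin d) ℂ) B]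
      [IsScalarTower ℂ (MvPolynomial (Fin d) ℂ) B] [Module.IsTorsionFree (MvPolynomial (Fin d) ℂ) B]
      [Algebra.IsIntegral (MvPolynomial (Fin d) ℂ) B] [Algebra.FiniteType ℂ B]
      (𝔪 : Ideal B) [𝔪.IsMaximal] (e₀ : B →ₐ[ℂ] ℂ), RingHom.ker (e₀ : B →+* ℂ) = 𝔪 →
      {ψ : B →ₐ[ℂ] ℂ | (fun i => ψ (algebraMap (MvPolynomial (Fin d) ℂ) B (MvPolynomial.X i))) =
        fun i => e₀ (algebraMap (MvPolynomial (Fin d) ℂ) B (MvPolynomial.X i))}.Finite →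
      (∀ ℓ : B, e₀ ℓ = 0 →
        (∀ ψ : B →ₐ[ℂ] ℂ, (fun i => ψ (algebraMap (MvPolynomial (Fin d) ℂ) B (MvPolynomial.X i))) =
          (fun i => e₀ (algebraMap (MvPolynomial (Fin d) ℂ) B (MvPolynomial.X i))) → ψ ℓ = 0 → ψ = e₀) →
        ∃ G : Polynomial (MvPolynomial (Fin d) ℂ), Polynomial.aeval ℓ G = 0 ∧
          ((G.map (MvPolynomial.eval fun i =>
            e₀ (algebraMap (MvPolynomial (Fin d) ℂ) B (MvPolynomial.X i)))).derivative).eval 0 ≠ 0) →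
      IsRegularLocalRing (Localization.AtPrime 𝔪) ∧ ringKrullDim (Localization.AtPrime 𝔪) = d :=
  fun _ _ _ _ _ _ _ _ _ _ 𝔪 _ e₀ he₀ hfin hbranch =>
    LocalRegularity.isRegularLocalRing_of_branches 𝔪 e₀ he₀ hfin hbranch

end Summit.HodgeConjecture.HodgeConjecture.Theorems.RiemannWeightOne

end
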